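import Summits.BirchSwinnertonDyer.Rank1Residual.AdditivePotMult.RankOneIndexCertificate
import HarnessLib

/-!
# Rank ONE at ANY bad odd prime, NO image hypothesis: the EXACT `ord_p #Ш(E)_an` from the Heegner-index
# VALUATION, the twist's central value and the torsion — and `BSD(E,p)` from that balance plus a descent
# certificate `Ш(E)[p] = 0` (cell `b2b-bsdres`, sub-cell additive-p1, gen 10)

HONEST FRAMING (cell `b2b-bsdres`, run/shared/lean/b2b/bsd-rank1-residual/, verbatim in every
file): the goal of the cell is to DELETE the COMBINATION-SHAPED residual classes of the
Birch–Swinnerton-Dyer formula for ALL analytic-rank `≤ 1` elliptic curves over `ℚ` — "full BSD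
formula for every rank `≤ 1` curve in class `C`" assembled STRICTLY from published theorems — so
that the rank-`≤ 1` remainder becomes exactly the CONSTRUCTION-SHAPED classes, which are TYPED
(missing-input `Prop`s), NOT attempted. This is not "finishing BSD". Sub-cell additive-p1 is a
RESEARCH ROUTE on the construction-shaped classes X3♯(M) / X4(M) (additive, potentially
multiplicative `p`); no claim beyond the stated sub-classes; X3/X4 labels are UNCHANGED by this file;
NOTHING is booked here (a per-pair closure is the referee's ruling on the lane's certificates).

THEOREMS ONLY (no definition, no named fact). PER PAIR, not a class theorem; class-agnostic.

WHY. At an additive prime `p` of a curve of analytic rank ONE the census closes a pair per curve by a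
`p`-descent certificate `Ш(E)[p] = 0` TOGETHER WITH the exact value `ord_p #Ш(E)_an = 0`
(`Typed.bsdp_of_shaAn_unit_of_noPTorsion`), and in rank one `#Ш(E)_an = L'(E,1)·#tors²/(Ω·Reg·∏c)`
is a statement about a real number. Gen 5's `padicValRat_shaAn_eq_zero_of_indexCertificate` makes
it a finite certificate (`p ∤ [E(K):ℤP]`, `ord_p L(E^{d_K},1)/Ω = 0`, `p ∤ ∏c_ℓ(E)`) — but under
`E[p]` IRREDUCIBLE and in the UNIT case only, and its companion `bsdp_of_rankOne_of_indexCertificate`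
needs `ρ̄_{E,p}` ONTO (Kolyvagin's quantitative bound). On this sub-cell's census at `p = 3` that
leaves out: the 221 rank-one X3♯(M) pairs (`E[3]` REDUCIBLE), the 33 rank-one X4(M) pairs with
`3 ∣ ∏c_ℓ(E)` (index never prime to `3`), and the 2 with image `3Ns`. For all of them multr1-p2's
Gross–Zagier bookkeeping identity `X11b.exists_shaAn_padicVal_eq_of_heegner` (JSW 2017 (eq:gz for
K′); PUBLISHED binders Gross–Zagier / Cai–Shu–Tian `hGZ`, Kolyvagin's QUALITATIVE Thm. A `hKo` — no
image hypothesis —, GZK `hGZK`, modularity `hmod`) still computes `ord_p #Ш(E)_an` EXACTLY from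
finite data:
  `ord_p #Ш(E)_an = 2·ord_p [E(K):ℤP] − ord_p (L(E^{d_K},1)/Ω) − ord_p ∏_ℓ c_ℓ(E) − 2·ord_p #E^{d_K}(ℚ)_tors`.

* §1 `exists_shaAn_padicVal_eq_of_indexValuation` — that display (any level-`N` datum with
  `p ∤ c(Dt)`, `p ∤ w_K`, `ord_p u(Cd) = 0`; no irreducibility, no surjectivity, no Tamagawa
  condition); `bsdp_of_rankOne_of_indexBalance_of_noPTorsion` — if the finite BALANCE
  `2·ord_p [E(K):ℤP] = ord_p (L(E^{d_K},1)/Ω) + ord_p ∏c_ℓ(E) + 2·ord_p #E^{d_K}(ℚ)_tors` holds and a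
  descent certificate gives `Ш(E)[p] = 0`, then `BSD(E,p)`.
* §2 conductor level, `p ∣ N_E` odd, `d_K < −4`: `…_of_dvd` forms with `ord_p u = 0` and `p ∤ w_K`
  DISCHARGED (`padicValRat_u_eq_zero_of_twist_minimal_of_dvd`, `w_K = 2`).
* §3 readings for this sub-cell: `ClassX3M.bsdp_rankOne_of_indexBalance_of_noPTorsion`,
  `ClassX4M.bsdp_rankOne_of_indexBalance_of_noPTorsion` (any odd `p`; `p ∣ N_E` from additivity).

The index here is the TRUE index `[E(K) : ℤP]` (torsion included: for `E(K) ≅ ℤg ⊕ T` and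
`P = n g + t`, `[E(K):ℤP] = n·#T`); the engines' `m = √(4ρ)` measures `n` — the lane converts with
`#E(K)[p^∞] = #E(ℚ)[p^∞]·#E^{d_K}(ℚ)[p^∞]` (`p` odd). Per pair; nothing booked.

References: [JetchevSkinnerWan2017] §7.4.1; [GrossZagier1986] V.§2; [CaiShuTian2014] Thm. 1.1;
[GrossLMS1991] Thm. 1.3 (1); [Kolyvagin1990] Thm. A; [Miller2011LMS] Def. 1.1.
-/

noncomputable section

open scoped Classical NumberField

open WeierstrassCurve NumberField Literature.NumberTheory.EllipticCurves
  Literature.NumberTheory.EllipticCurves.ModularForms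
  Literature.NumberTheory.EllipticCurves.Rank1Residual
  Literature.NumberTheory.EllipticCurves.Rank1Residual.Typed
  Literature.NumberTheory.Automorphic
  IsDedekindDomain

namespace Summit.BirchSwinnertonDyer.Rank1Residual.AdditivePotMult

/-! ### §1 Data level, any odd `p`, any level: the exact valuation and the balance certificate -/

/-- **`ord_p #Ш(E)_an` EXACTLY from the index valuation, rank one, ANY odd `p`, ANY reduction type, NO
image hypothesis.** Data: `W/ℚ` globally minimal with `ord_{s=1} L(E,s) = 1`; `K` imaginary quadratic
with the Heegner hypothesis for the level `N`; `P ∈ E(K)` the Heegner point of a parametrisation datum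
`Dt` with `p ∤ c(Dt)`; `p ∤ #𝓞_K^×`; `L(E^{(d_K)},1) ≠ 0`; `Wd = Cd • W^{(d_K)}` a globally minimal
model with `ord_p u(Cd) = 0`; `q_d = L(Wd,1)/Ω(Wd)`. CONCLUSION: `#Ш(E)_an = q ∈ ℚ` with
`ord_p q = 2·ord_p [E(K):ℤP] − ord_p q_d − ord_p ∏_ℓ c_ℓ(E) − 2·ord_p #Wd(ℚ)_tors`. This is
multr1-p2's identity `X11b.exists_shaAn_padicVal_eq_of_heegner` solved for `ord_p q`. PUBLISHED
binders: `hGZ`, `hKo` (qualitative), `hGZK`, `hmod`. Per pair.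
[cite: JetchevSkinnerWan2017, §7.4.1 (eq:gz for K′), p. 30] [cite: GrossZagier1986, V.§2 (pp. 310–312)]
[cite: Miller2011LMS, §1 and Def. 1.1] -/
theorem exists_shaAn_padicVal_eq_of_indexValuation
    (W : WeierstrassCurve ℚ) [W.IsElliptic] [W.IsGloballyMinimal] (p : ℕ) [Fact p.Prime]
    (N : ℕ) [NeZero N] (K : Type) [Field K] [NumberField K]
    (Dt : ModularParametrizationData W N) (H : HeegnerDatum N (NumberField.discr K)) (ι : K →+* ℂ)
    (P : (W.baseChange K).toAffine.Point)
    -- the published inputs (named facts of the tree)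
    (hGZ : gross_zagier N W K) (hKo : kolyvagin N W K)
    (hGZK : rank_eq_analyticRank_of_analyticRank_le_one) (hmod : hasEntireLFunction_rat)
    -- the pair and the Heegner data
    (hK : IsImaginaryQuadratic K) (hHN : SatisfiesHeegnerHypothesis N K)
    (hP : WeierstrassCurve.Affine.Point.map ι.toRatAlgHom P = heegnerPointComplex Dt H)
    (hp2 : p ≠ 2) (hc : ¬ (p : ℤ) ∣ Dt.c) (hμ : ¬ p ∣ Units.torsionOrder K)
    (hr : W.analyticRank = 1)
    (hLt : (W.quadraticTwist (NumberField.discr K : ℚ)).entireLFunction 1 ≠ 0)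
    (Wd : WeierstrassCurve ℚ) [Wd.IsElliptic] [Wd.IsGloballyMinimal] (Cd : VariableChange ℚ)
    (hWd : Cd • W.quadraticTwist (NumberField.discr K : ℚ) = Wd)
    (hu : padicValRat p (Cd.u : ℚ) = 0)
    -- the twist's algebraic central value (a datum)
    (qd : ℚ) (hqd : Wd.entireLFunction 1 / (Wd.realPeriodRat : ℂ) = (qd : ℂ)) :
    ∃ q : ℚ, shaAn W = (q : ℂ) ∧
      padicValRat p q = 2 * (padicValNat p (AddSubgroup.zmultiples P).index : ℤ) - padicValRat p qd -
        padicValNat p W.tamagawaProduct - 2 * padicValNat p Wd.torsionOrder := by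
  obtain ⟨-, -, -, q, hq, hid⟩ :=
    X11b.exists_shaAn_padicVal_eq_of_heegner W p N K Dt H ι P hGZ hKo hGZK hmod hK hHN hP hp2 hc hμ
      hr hLt Wd Cd hWd hu qd hqd
  exact ⟨q, hq, by omega⟩

/-- **`BSD(E,p)` in rank one from the index BALANCE and a descent certificate — ANY odd `p`, ANY
reduction type, NO image hypothesis.** Same data as `exists_shaAn_padicVal_eq_of_indexValuation`;
CERTIFICATE: the finite balance `2·ord_p [E(K):ℤP] = ord_p q_d + ord_p ∏_ℓ c_ℓ(E) + 2·ord_p #Wd(ℚ)_tors`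
(so `ord_p #Ш(E)_an = 0`) and `Ш(E/ℚ)[p] = 0` (a `p`-descent / `p`-isogeny-descent certificate).
CONCLUSION: `BSDp W p` (the cell's `Typed.bsdp_of_shaAn_unit_of_noPTorsion`). Reaches, per pair,
rank-one pairs with `E[p]` REDUCIBLE (X3♯(M), X2c) and Tamagawa-obstructed ones (`p ∣ ∏c_ℓ`), where
Kolyvagin's quantitative bound is unavailable or the index is never prime to `p`. Per pair; nothing
booked. [cite: JetchevSkinnerWan2017, §7.4.1 (eq:gz for K′), p. 30] [cite: Miller2011LMS, §1 and Def. 1.1] -/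
theorem bsdp_of_rankOne_of_indexBalance_of_noPTorsion
    (W : WeierstrassCurve ℚ) [W.IsElliptic] [W.IsGloballyMinimal] (p : ℕ) [Fact p.Prime]
    (N : ℕ) [NeZero N] (K : Type) [Field K] [NumberField K]
    (Dt : ModularParametrizationData W N) (H : HeegnerDatum N (NumberField.discr K)) (ι : K →+* ℂ)
    (P : (W.baseChange K).toAffine.Point)
    (hGZ : gross_zagier N W K) (hKo : kolyvagin N W K)
    (hGZK : rank_eq_analyticRank_of_analyticRank_le_one) (hmod : hasEntireLFunction_rat)
    (hK : IsImaginaryQuadratic K) (hHN : SatisfiesHeegnerHypothesis N K)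
    (hP : WeierstrassCurve.Affine.Point.map ι.toRatAlgHom P = heegnerPointComplex Dt H)
    (hp2 : p ≠ 2) (hc : ¬ (p : ℤ) ∣ Dt.c) (hμ : ¬ p ∣ Units.torsionOrder K)
    (hr : W.analyticRank = 1)
    (hLt : (W.quadraticTwist (NumberField.discr K : ℚ)).entireLFunction 1 ≠ 0)
    (Wd : WeierstrassCurve ℚ) [Wd.IsElliptic] [Wd.IsGloballyMinimal] (Cd : VariableChange ℚ)
    (hWd : Cd • W.quadraticTwist (NumberField.discr K : ℚ) = Wd)
    (hu : padicValRat p (Cd.u : ℚ) = 0)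
    (qd : ℚ) (hqd : Wd.entireLFunction 1 / (Wd.realPeriodRat : ℂ) = (qd : ℂ))
    -- the certificate: the balance and the descent
    (hbal : 2 * (padicValNat p (AddSubgroup.zmultiples P).index : ℤ) =
      padicValRat p qd + padicValNat p W.tamagawaProduct + 2 * padicValNat p Wd.torsionOrder)
    (hSha : ∀ x : W.sha, (p : ℤ) • x = 0 → x = 0) : BSDp W p := by
  obtain ⟨q, hq, hv⟩ := exists_shaAn_padicVal_eq_of_indexValuation W p N K Dt H ι P hGZ hKo hGZK hmod hK
    hHN hP hp2 hc hμ hr hLt Wd Cd hWd hu qd hqd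
  have hv0 : padicValRat p q = 0 := by rw [hv]; omega
  exact bsdp_of_shaAn_unit_of_noPTorsion W p hGZK (by rw [hr]) hq hv0 hSha

/-! ### §2 Conductor level, `p ∣ N_E` odd, `d_K < -4`: the two side values discharged -/

/-- **The exact valuation at the conductor level, any odd `p ∣ N_E`, `d_K < −4`** (`ord_p u(Cd) = 0` by
`padicValRat_u_eq_zero_of_twist_minimal_of_dvd`, `p ∤ w_K = 2`). Per pair.
[cite: JetchevSkinnerWan2017, §7.4.1 (eq:gz for K′), p. 30] [cite: Miller2011LMS, Def. 1.1] -/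
theorem exists_shaAn_padicVal_eq_of_indexValuation_of_dvd
    (W : WeierstrassCurve ℚ) [W.IsElliptic] [W.IsGloballyMinimal] (p : ℕ) [Fact p.Prime]
    [NeZero (W.conductorNorm ℤ)] (K : Type) [Field K] [NumberField K]
    (Dt : ModularParametrizationData W (W.conductorNorm ℤ))
    (H : HeegnerDatum (W.conductorNorm ℤ) (NumberField.discr K)) (ι : K →+* ℂ)
    (P : (W.baseChange K).toAffine.Point)
    (hGZ : gross_zagier (W.conductorNorm ℤ) W K) (hKo : kolyvagin (W.conductorNorm ℤ) W K)
    (hGZK : rank_eq_analyticRank_of_analyticRank_le_one) (hmod : hasEntireLFunction_rat)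
    (hp2 : p ≠ 2) (hpN : p ∣ W.conductorNorm ℤ) (hr : W.analyticRank = 1)
    (hK : IsImaginaryQuadratic K) (hHN : SatisfiesHeegnerHypothesis (W.conductorNorm ℤ) K)
    (hdK : NumberField.discr K < -4)
    (hP : WeierstrassCurve.Affine.Point.map ι.toRatAlgHom P = heegnerPointComplex Dt H)
    (hc : ¬ (p : ℤ) ∣ Dt.c)
    (hLt : (W.quadraticTwist (NumberField.discr K : ℚ)).entireLFunction 1 ≠ 0)
    (Wd : WeierstrassCurve ℚ) [Wd.IsElliptic] [Wd.IsGloballyMinimal] (Cd : VariableChange ℚ)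
    (hWd : Cd • W.quadraticTwist (NumberField.discr K : ℚ) = Wd)
    (qd : ℚ) (hqd : Wd.entireLFunction 1 / (Wd.realPeriodRat : ℂ) = (qd : ℂ)) :
    ∃ q : ℚ, shaAn W = (q : ℂ) ∧
      padicValRat p q = 2 * (padicValNat p (AddSubgroup.zmultiples P).index : ℤ) - padicValRat p qd -
        padicValNat p W.tamagawaProduct - 2 * padicValNat p Wd.torsionOrder := by
  have hp : p.Prime := Fact.out
  have hμ : ¬ p ∣ Units.torsionOrder K := by
    rw [Literature.NumberTheory.DiophantineGeometry.torsionOrder_eq_two_of_discr_lt hK.1 hdK]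
    intro h2
    exact hp2 ((Nat.prime_dvd_prime_iff_eq hp Nat.prime_two).mp h2)
  have hu : padicValRat p (Cd.u : ℚ) = 0 :=
    padicValRat_u_eq_zero_of_twist_minimal_of_dvd W p K hK hHN hpN Cd hWd
  exact exists_shaAn_padicVal_eq_of_indexValuation W p (W.conductorNorm ℤ) K Dt H ι P hGZ hKo hGZK hmod
    hK hHN hP hp2 hc hμ hr hLt Wd Cd hWd hu qd hqd

/-- **`BSD(E,p)` at the conductor level from the index balance and `Ш(E)[p] = 0`, any odd `p ∣ N_E`,
`d_K < −4`, ANY reduction type and image.** Per pair; nothing booked.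
[cite: JetchevSkinnerWan2017, §7.4.1 (eq:gz for K′), p. 30] [cite: Miller2011LMS, §1 and Def. 1.1] -/
theorem bsdp_of_rankOne_of_indexBalance_of_noPTorsion_of_dvd
    (W : WeierstrassCurve ℚ) [W.IsElliptic] [W.IsGloballyMinimal] (p : ℕ) [Fact p.Prime]
    [NeZero (W.conductorNorm ℤ)] (K : Type) [Field K] [NumberField K]
    (Dt : ModularParametrizationData W (W.conductorNorm ℤ))
    (H : HeegnerDatum (W.conductorNorm ℤ) (NumberField.discr K)) (ι : K →+* ℂ)
    (P : (W.baseChange K).toAffine.Point)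
    (hGZ : gross_zagier (W.conductorNorm ℤ) W K) (hKo : kolyvagin (W.conductorNorm ℤ) W K)
    (hGZK : rank_eq_analyticRank_of_analyticRank_le_one) (hmod : hasEntireLFunction_rat)
    (hp2 : p ≠ 2) (hpN : p ∣ W.conductorNorm ℤ) (hr : W.analyticRank = 1)
    (hK : IsImaginaryQuadratic K) (hHN : SatisfiesHeegnerHypothesis (W.conductorNorm ℤ) K)
    (hdK : NumberField.discr K < -4)
    (hP : WeierstrassCurve.Affine.Point.map ι.toRatAlgHom P = heegnerPointComplex Dt H)
    (hc : ¬ (p : ℤ) ∣ Dt.c)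
    (hLt : (W.quadraticTwist (NumberField.discr K : ℚ)).entireLFunction 1 ≠ 0)
    (Wd : WeierstrassCurve ℚ) [Wd.IsElliptic] [Wd.IsGloballyMinimal] (Cd : VariableChange ℚ)
    (hWd : Cd • W.quadraticTwist (NumberField.discr K : ℚ) = Wd)
    (qd : ℚ) (hqd : Wd.entireLFunction 1 / (Wd.realPeriodRat : ℂ) = (qd : ℂ))
    (hbal : 2 * (padicValNat p (AddSubgroup.zmultiples P).index : ℤ) =
      padicValRat p qd + padicValNat p W.tamagawaProduct + 2 * padicValNat p Wd.torsionOrder)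
    (hSha : ∀ x : W.sha, (p : ℤ) • x = 0 → x = 0) : BSDp W p := by
  have hp : p.Prime := Fact.out
  have hμ : ¬ p ∣ Units.torsionOrder K := by
    rw [Literature.NumberTheory.DiophantineGeometry.torsionOrder_eq_two_of_discr_lt hK.1 hdK]
    intro h2
    exact hp2 ((Nat.prime_dvd_prime_iff_eq hp Nat.prime_two).mp h2)
  have hu : padicValRat p (Cd.u : ℚ) = 0 :=
    padicValRat_u_eq_zero_of_twist_minimal_of_dvd W p K hK hHN hpN Cd hWd
  exact bsdp_of_rankOne_of_indexBalance_of_noPTorsion W p (W.conductorNorm ℤ) K Dt H ι P hGZ hKo hGZK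
    hmod hK hHN hP hp2 hc hμ hr hLt Wd Cd hWd hu qd hqd hbal hSha

/-! ### §3 Readings for this sub-cell: X3♯(M) (reducible) and X4(M), rank one, any odd `p` -/

variable {W : WeierstrassCurve ℚ} [W.IsElliptic] {p : ℕ} [Fact p.Prime]

/-- **X3♯(M), rank one, ANY odd `p`: `BSD(E,p)` from the index balance and `Ш(E)[p] = 0`** — the first
per-pair lever of the cell on the rank-one X3♯(M) pairs (`E[p]` reducible: no Kolyvagin bound in
print; 221 census pairs at `p = 3`, 15 at `p ≥ 5`): Gross–Zagier + Kolyvagin's qualitative theorem +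
finite data + a descent certificate. X3♯(M) stays CONSTRUCTION-SHAPED; nothing booked.
[cite: JetchevSkinnerWan2017, §7.4.1 (eq:gz for K′), p. 30] [cite: Miller2011LMS, §1 and Def. 1.1] -/
theorem ClassX3M.bsdp_rankOne_of_indexBalance_of_noPTorsion [W.IsGloballyMinimal]
    [NeZero (W.conductorNorm ℤ)]
    (hX : ClassX3M W p) (hr : W.analyticRank = 1)
    (K : Type) [Field K] [NumberField K]
    (Dt : ModularParametrizationData W (W.conductorNorm ℤ))
    (H : HeegnerDatum (W.conductorNorm ℤ) (NumberField.discr K)) (ι : K →+* ℂ)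
    (P : (W.baseChange K).toAffine.Point)
    (hGZ : gross_zagier (W.conductorNorm ℤ) W K) (hKo : kolyvagin (W.conductorNorm ℤ) W K)
    (hGZK : rank_eq_analyticRank_of_analyticRank_le_one) (hmod : hasEntireLFunction_rat)
    (hK : IsImaginaryQuadratic K) (hHN : SatisfiesHeegnerHypothesis (W.conductorNorm ℤ) K)
    (hdK : NumberField.discr K < -4)
    (hP : WeierstrassCurve.Affine.Point.map ι.toRatAlgHom P = heegnerPointComplex Dt H)
    (hc : ¬ (p : ℤ) ∣ Dt.c)
    (hLt : (W.quadraticTwist (NumberField.discr K : ℚ)).entireLFunction 1 ≠ 0)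
    (Wd : WeierstrassCurve ℚ) [Wd.IsElliptic] [Wd.IsGloballyMinimal] (Cd : VariableChange ℚ)
    (hWd : Cd • W.quadraticTwist (NumberField.discr K : ℚ) = Wd)
    (qd : ℚ) (hqd : Wd.entireLFunction 1 / (Wd.realPeriodRat : ℂ) = (qd : ℂ))
    (hbal : 2 * (padicValNat p (AddSubgroup.zmultiples P).index : ℤ) =
      padicValRat p qd + padicValNat p W.tamagawaProduct + 2 * padicValNat p Wd.torsionOrder)
    (hSha : ∀ x : W.sha, (p : ℤ) • x = 0 → x = 0) : BSDp W p :=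
  have hpN : p ∣ W.conductorNorm ℤ :=
    (W.dvd_conductorNorm_iff_not_hasGoodReductionAtPrime p).mpr hX.potMult.not_good
  bsdp_of_rankOne_of_indexBalance_of_noPTorsion_of_dvd W p K Dt H ι P hGZ hKo hGZK hmod hX.p_ne_two hpN hr
    hK hHN hdK hP hc hLt Wd Cd hWd qd hqd hbal hSha

/-- **X4(M), rank one, ANY odd `p`, ANY image, ANY Tamagawa numbers: `BSD(E,p)` from the index balance
and `Ш(E)[p] = 0`** (serves the 33 rank-one X4(M) pairs at `p = 3` with `3 ∣ ∏c_ℓ(E)` and the 2 with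
image `3Ns`, outside `RankOneIndexCertificateOdd.lean`). X4(M) stays CONSTRUCTION-SHAPED; nothing
booked. [cite: JetchevSkinnerWan2017, §7.4.1 (eq:gz for K′), p. 30] [cite: Miller2011LMS, §1 and Def. 1.1] -/
theorem ClassX4M.bsdp_rankOne_of_indexBalance_of_noPTorsion [W.IsGloballyMinimal]
    [NeZero (W.conductorNorm ℤ)]
    (hX : ClassX4M W p) (hr : W.analyticRank = 1)
    (K : Type) [Field K] [NumberField K]
    (Dt : ModularParametrizationData W (W.conductorNorm ℤ))
    (H : HeegnerDatum (W.conductorNorm ℤ) (NumberField.discr K)) (ι : K →+* ℂ)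
    (P : (W.baseChange K).toAffine.Point)
    (hGZ : gross_zagier (W.conductorNorm ℤ) W K) (hKo : kolyvagin (W.conductorNorm ℤ) W K)
    (hGZK : rank_eq_analyticRank_of_analyticRank_le_one) (hmod : hasEntireLFunction_rat)
    (hK : IsImaginaryQuadratic K) (hHN : SatisfiesHeegnerHypothesis (W.conductorNorm ℤ) K)
    (hdK : NumberField.discr K < -4)
    (hP : WeierstrassCurve.Affine.Point.map ι.toRatAlgHom P = heegnerPointComplex Dt H)
    (hc : ¬ (p : ℤ) ∣ Dt.c)
    (hLt : (W.quadraticTwist (NumberField.discr K : ℚ)).entireLFunction 1 ≠ 0)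
    (Wd : WeierstrassCurve ℚ) [Wd.IsElliptic] [Wd.IsGloballyMinimal] (Cd : VariableChange ℚ)
    (hWd : Cd • W.quadraticTwist (NumberField.discr K : ℚ) = Wd)
    (qd : ℚ) (hqd : Wd.entireLFunction 1 / (Wd.realPeriodRat : ℂ) = (qd : ℂ))
    (hbal : 2 * (padicValNat p (AddSubgroup.zmultiples P).index : ℤ) =
      padicValRat p qd + padicValNat p W.tamagawaProduct + 2 * padicValNat p Wd.torsionOrder)
    (hSha : ∀ x : W.sha, (p : ℤ) • x = 0 → x = 0) : BSDp W p :=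
  have hpN : p ∣ W.conductorNorm ℤ :=
    (W.dvd_conductorNorm_iff_not_hasGoodReductionAtPrime p).mpr hX.potMult.not_good
  bsdp_of_rankOne_of_indexBalance_of_noPTorsion_of_dvd W p K Dt H ι P hGZ hKo hGZK hmod hX.p_ne_two hpN hr
    hK hHN hdK hP hc hLt Wd Cd hWd qd hqd hbal hSha

end Summit.BirchSwinnertonDyer.Rank1Residual.AdditivePotMult

end
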